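import Literature.Combinatorics.Enumerative.JacobiIdentityPowerSeries
import Literature.Combinatorics.Enumerative.EulerPentagonalAnalytic
import Mathlib.Algebra.Polynomial.Eval.Degree
import Mathlib.RingTheory.PowerSeries.Basic
import Mathlib.RingTheory.PowerSeries.Order
import Mathlib.Analysis.SpecialFunctions.Log.Summable
import Mathlib.Analysis.Normed.Group.Tannery
import Mathlib.Analysis.SpecificLimits.Normed
import Mathlib.Topology.Algebra.InfiniteSum.NatInt

/-!
# Jacobi's identity `∏ (1 − xⁿ)³ = Σ (−1)ᵐ (2m+1) x^{½m(m+1)}` at a point (Hardy–Wright Theorem 357)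

Hardy–Wright, *An Introduction to the Theory of Numbers*, §19.9, Theorem 357 (Jacobi):

> `∏_{n=1}^{∞} (1 − xⁿ)³ = Σ_{m=0}^{∞} (−1)ᵐ (2m+1) x^{½m(m+1)}`,

an identity for `|x| < 1` (§19.3: «the series and products with which we deal are all absolutely
convergent … for `|x| < 1`»).

The tree has Theorem 357 for *formal* power series (`JacobiIdentityPowerSeries`: `hasSum_jacobi`,
and, for the partial products `P_M = (1 − x)⋯(1 − x^M)`, the coefficient formula
`coeff_prod_pow_three`: `coeff_d (P_M³) = Σ_{j<2(d+1)} [½j(j+1) = d] (−1)ʲ (2j+1)` for `M ≥ d`).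
This file proves the identity **at a point** `x` of a complete normed field with `‖x‖ < 1`, by the
standard passage from coefficients to values («its truth for `|x| < 1` follows at once from
familiar theorems of analysis», §19.3):

1. `P_M(x)³ = Σ_d coeff_d(P_M³) x^d` (a polynomial identity);
2. `|coeff_d(P_M³)| ≤ coeff_d(Q_M³)`, `Q_M = (1 + x)⋯(1 + x^M) ∈ ℝ⟦X⟧` (majorant with non-negative
   coefficients), and `coeff_d(Q_M³) ≤ coeff_d(Q_d³) =: B_d` for every `M` (the coefficients of
   `Q_M³` increase with `M` and are stationary from `M = d` on);
3. `Σ_{d<N} B_d r^d ≤ Q_N(r)³ ≤ e^{3r/(1−r)}` for `0 ≤ r < 1`, so `Σ B_d r^d < ∞`;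
4. dominated convergence (Tannery) as `M → ∞`: `Σ_d coeff_d(P_M³) x^d → Σ_d c_d x^d` termwise
   (the coefficients are stationary) while `P_M(x)³ → (∏ (1 − xⁿ))³`.

## Main statements (`‖x‖ < 1`)

* `hasSum_coeff_prod_one_sub_pow_three_mul_pow` — step 1;
* `norm_coeff_prod_one_sub_pow_three_le` — steps 2–3's uniform bound;
* `hasSum_jacobi` — **Theorem 357 at a point** (the product converges by
  `EulerPentagonalAnalytic.multipliable_one_sub_pow_succ`):
  `Σ_{m≥0} (−1)ᵐ (2m+1) x^{m(m+1)/2} = (∏_{n≥1} (1 − xⁿ))³`;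
* `tprod_one_sub_pow_succ_pow_three_eq_tsum` — the same as an equation.

## References
* [HardyWright2008] G. H. Hardy, E. M. Wright, *An Introduction to the Theory of Numbers*, 6th ed.
  (OUP 2008), §19.9 Theorem 357; §19.3 (convergence for `|x| < 1`).
-/

noncomputable section

open Finset Filter Topology PowerSeries
open Literature.Combinatorics.Enumerative.JacobiIdentity
open Literature.Combinatorics.Enumerative.EulerPentagonalAnalytic (multipliable_one_sub_pow_succ)

namespace Literature.Combinatorics.Enumerative.JacobiIdentityAnalytic

/-! ### §1. Values of a polynomial from its coefficients -/

section Polynomial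

variable {R : Type*} [CommRing R] [TopologicalSpace R]

/-- `q(x) = Σ_d coeff_d(q) x^d` for a polynomial `q`, as a `HasSum` over all `d`. [folklore] -/
private theorem hasSum_coeff_coe_mul_pow (q : Polynomial R) (x : R) :
    HasSum (fun d ↦ coeff d (q : R⟦X⟧) * x ^ d) (q.eval x) := by
  rw [Polynomial.eval_eq_sum_range]
  simp_rw [Polynomial.coeff_coe]
  exact hasSum_sum_of_ne_finset_zero fun d hd ↦ by
    rw [mem_range, not_lt] at hd
    rw [Polynomial.coeff_eq_zero_of_natDegree_lt (by omega), zero_mul]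

omit [TopologicalSpace R] in
/-- The polynomial `((1 ∓ X)⋯(1 ∓ X^M))^k` seen in `R⟦X⟧`. [folklore] -/
private theorem coe_prod_one_add_C_mul_X_pow_pow (c : R) (M k : ℕ) :
    (((∏ t ∈ range M, (1 + Polynomial.C c * Polynomial.X ^ (t + 1))) ^ k : Polynomial R) : R⟦X⟧) =
      (∏ t ∈ range M, (1 + C c * (X : R⟦X⟧) ^ (t + 1))) ^ k := by
  change Polynomial.coeToPowerSeries.ringHom (R := R)
    ((∏ t ∈ range M, (1 + Polynomial.C c * Polynomial.X ^ (t + 1))) ^ k) = _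
  rw [map_pow, map_prod]
  congr 1
  refine prod_congr rfl fun t _ ↦ ?_
  rw [map_add, map_one, map_mul, map_pow, Polynomial.coeToPowerSeries.ringHom_apply,
    Polynomial.coeToPowerSeries.ringHom_apply, Polynomial.coe_X, Polynomial.coe_C]

/-- **Step 1**: `((1 + c x)⋯(1 + c x^M))^k = Σ_d coeff_d x^d` for every `x` (here `c = −1` gives
the partial products of `∏ (1 − xⁿ)`, `c = 1` the majorant). [cite: HardyWright2008, §19.3] -/
theorem hasSum_coeff_prod_one_add_C_mul_X_pow_pow_mul_pow (c x : R) (M k : ℕ) :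
    HasSum (fun d ↦ coeff d ((∏ t ∈ range M, (1 + C c * (X : R⟦X⟧) ^ (t + 1))) ^ k) * x ^ d)
      ((∏ t ∈ range M, (1 + c * x ^ (t + 1))) ^ k) := by
  have h := hasSum_coeff_coe_mul_pow
    ((∏ t ∈ range M, (1 + Polynomial.C c * Polynomial.X ^ (t + 1))) ^ k : Polynomial R) x
  rw [coe_prod_one_add_C_mul_X_pow_pow] at h
  simpa [Polynomial.eval_prod] using h

/-- **Step 1 for `P_M³`**: `((1 − x)⋯(1 − x^M))³ = Σ_d coeff_d(P_M³) x^d`, `P_M ∈ R⟦X⟧` the partial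
product of the tree's `JacobiIdentityPowerSeries`. [cite: HardyWright2008, §19.9 Thm 357] -/
theorem hasSum_coeff_prod_one_sub_pow_three_mul_pow (x : R) (M : ℕ) :
    HasSum (fun d ↦ coeff d ((∏ t ∈ range M, (1 - (X : R⟦X⟧) ^ (t + 1))) ^ 3) * x ^ d)
      ((∏ t ∈ range M, (1 - x ^ (t + 1))) ^ 3) := by
  have h := hasSum_coeff_prod_one_add_C_mul_X_pow_pow_mul_pow (-1 : R) x M 3
  simp only [map_neg, map_one, neg_mul, one_mul, ← sub_eq_add_neg] at h
  exact h

end Polynomial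

/-! ### §2. The majorant `Q_M = (1 + X)⋯(1 + X^M)` -/

section Majorant

variable {𝕜 : Type*} [NormedField 𝕜]

/-- Majorization is preserved by products. [folklore] -/
private theorem norm_coeff_mul_le {f g : 𝕜⟦X⟧} {F G : ℝ⟦X⟧} (hf : ∀ n, ‖coeff n f‖ ≤ coeff n F)
    (hg : ∀ n, ‖coeff n g‖ ≤ coeff n G) (n : ℕ) : ‖coeff n (f * g)‖ ≤ coeff n (F * G) := by
  rw [coeff_mul, coeff_mul]
  refine (norm_sum_le _ _).trans (sum_le_sum fun p _ ↦ ?_)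
  rw [norm_mul]
  exact mul_le_mul (hf _) (hg _) (norm_nonneg _) ((norm_nonneg _).trans (hf _))

/-- Majorization is preserved by finite products. [folklore] -/
private theorem norm_coeff_prod_le (M : ℕ) {f : ℕ → 𝕜⟦X⟧} {F : ℕ → ℝ⟦X⟧}
    (h : ∀ t n, ‖coeff n (f t)‖ ≤ coeff n (F t)) (n : ℕ) :
    ‖coeff n (∏ t ∈ range M, f t)‖ ≤ coeff n (∏ t ∈ range M, F t) := by
  induction M generalizing n with
  | zero =>
    simp only [prod_range_zero, coeff_one]
    split_ifs <;> simp
  | succ M ih =>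
    rw [prod_range_succ, prod_range_succ]
    exact norm_coeff_mul_le ih (h M) n

/-- Majorization is preserved by powers. [folklore] -/
private theorem norm_coeff_pow_le {f : 𝕜⟦X⟧} {F : ℝ⟦X⟧} (hf : ∀ n, ‖coeff n f‖ ≤ coeff n F)
    (k n : ℕ) : ‖coeff n (f ^ k)‖ ≤ coeff n (F ^ k) := by
  induction k generalizing n with
  | zero =>
    simp only [pow_zero, coeff_one]
    split_ifs <;> simp
  | succ k ih =>
    rw [pow_succ, pow_succ]
    exact norm_coeff_mul_le ih hf n

/-- `1 + X^{t+1}` majorizes `1 − X^{t+1}`. [folklore] -/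
private theorem norm_coeff_one_sub_X_pow_le (t n : ℕ) :
    ‖coeff n (1 - (X : 𝕜⟦X⟧) ^ (t + 1))‖ ≤ coeff n (1 + C 1 * (X : ℝ⟦X⟧) ^ (t + 1)) := by
  rw [map_one, one_mul, map_sub, map_add, coeff_one, coeff_one, coeff_X_pow, coeff_X_pow]
  split_ifs <;> simp

/-- **Step 2, first half**: `|coeff_n (P_M³)| ≤ coeff_n (Q_M³)`, `Q_M = (1 + X)⋯(1 + X^M) ∈ ℝ⟦X⟧`.
[cite: HardyWright2008, §19.3] -/
theorem norm_coeff_prod_pow_three_le_coeff_majorant (M n : ℕ) :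
    ‖coeff n ((∏ t ∈ range M, (1 - (X : 𝕜⟦X⟧) ^ (t + 1))) ^ 3)‖ ≤
      coeff n ((∏ t ∈ range M, (1 + C 1 * (X : ℝ⟦X⟧) ^ (t + 1))) ^ 3) :=
  norm_coeff_pow_le (norm_coeff_prod_le M (fun t n ↦ norm_coeff_one_sub_X_pow_le t n)) 3 n

/-- Non-negativity of coefficients is preserved by products. [folklore] -/
private theorem coeff_mul_nonneg {F G : ℝ⟦X⟧} (hF : ∀ n, 0 ≤ coeff n F) (hG : ∀ n, 0 ≤ coeff n G)
    (n : ℕ) : 0 ≤ coeff n (F * G) := by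
  rw [coeff_mul]
  exact sum_nonneg fun p _ ↦ mul_nonneg (hF _) (hG _)

/-- The coefficients of `Q`-type products `(∏_{t ∈ s} (1 + X^{t+1}))^k` are non-negative. [folklore] -/
private theorem coeff_majorant_nonneg (s : Finset ℕ) (k n : ℕ) :
    0 ≤ coeff n ((∏ t ∈ s, (1 + C 1 * (X : ℝ⟦X⟧) ^ (t + 1))) ^ k) := by
  have hprod : ∀ n, 0 ≤ coeff n (∏ t ∈ s, (1 + C 1 * (X : ℝ⟦X⟧) ^ (t + 1))) := by
    induction s using Finset.cons_induction with
    | empty => intro n; simp only [prod_empty, coeff_one]; split_ifs <;> simp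
    | cons a s ha ih =>
      intro n
      rw [prod_cons]
      refine coeff_mul_nonneg (fun n ↦ ?_) ih n
      rw [map_one, one_mul, map_add, coeff_one, coeff_X_pow]
      split_ifs <;> simp
  induction k generalizing n with
  | zero => simp only [pow_zero, coeff_one]; split_ifs <;> simp
  | succ k ih => rw [pow_succ]; exact coeff_mul_nonneg ih hprod n

/-- The constant term of a `Q`-type product is `1`. [folklore] -/
private theorem coeff_zero_majorant (s : Finset ℕ) (k : ℕ) :
    coeff 0 ((∏ t ∈ s, (1 + C 1 * (X : ℝ⟦X⟧) ^ (t + 1))) ^ k) = 1 := by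
  rw [coeff_zero_eq_constantCoeff_apply, map_pow, map_prod]
  simp

/-- Multiplying by a series with non-negative coefficients and constant term `1` does not decrease
non-negative coefficients. [folklore] -/
private theorem coeff_le_coeff_mul {F G : ℝ⟦X⟧} (hF : ∀ n, 0 ≤ coeff n F) (hG : ∀ n, 0 ≤ coeff n G)
    (hG0 : coeff 0 G = 1) (n : ℕ) : coeff n F ≤ coeff n (F * G) := by
  rw [coeff_mul]
  have hmem : ((n, 0) : ℕ × ℕ) ∈ antidiagonal n := mem_antidiagonal.mpr (by simp)
  have h := Finset.single_le_sum (s := antidiagonal n)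
    (f := fun p : ℕ × ℕ ↦ coeff p.1 F * coeff p.2 G) (fun p _ ↦ mul_nonneg (hF _) (hG _)) hmem
  simpa [hG0] using h

/-- A `Q`-type product over indices `t ≥ n` is `≡ 1 (mod X^{n+1})`. [folklore] -/
private theorem X_pow_dvd_majorant_sub_one (n M k : ℕ) :
    (X : ℝ⟦X⟧) ^ (n + 1) ∣ (∏ t ∈ Ico n M, (1 + C 1 * (X : ℝ⟦X⟧) ^ (t + 1))) ^ k - 1 := by
  -- products of series `≡ 1` are `≡ 1`
  have hmul : ∀ A B : ℝ⟦X⟧, (X : ℝ⟦X⟧) ^ (n + 1) ∣ A - 1 → (X : ℝ⟦X⟧) ^ (n + 1) ∣ B - 1 →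
      (X : ℝ⟦X⟧) ^ (n + 1) ∣ A * B - 1 := by
    intro A B hA hB
    have e : A * B - 1 = (A - 1) * B + (B - 1) := by ring
    rw [e]
    exact dvd_add (hA.mul_right B) hB
  have hprod : (X : ℝ⟦X⟧) ^ (n + 1) ∣ (∏ t ∈ Ico n M, (1 + C 1 * (X : ℝ⟦X⟧) ^ (t + 1))) - 1 := by
    induction M with
    | zero => simp
    | succ M ih =>
      by_cases hnM : n ≤ M
      · rw [Finset.prod_Ico_succ_top hnM]
        refine hmul _ _ ih ?_
        rw [map_one, one_mul, add_sub_cancel_left]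
        exact pow_dvd_pow X (by omega)
      · rw [Finset.Ico_eq_empty (by omega), prod_empty, sub_self]
        exact dvd_zero _
  induction k with
  | zero => simp
  | succ k ih => rw [pow_succ]; exact hmul _ _ ih hprod

/-- Multiplying by a series `≡ 1 (mod X^{n+1})` does not change the `n`-th coefficient. [folklore] -/
private theorem coeff_mul_eq_of_X_pow_dvd {F G : ℝ⟦X⟧} {n : ℕ} (hG : (X : ℝ⟦X⟧) ^ (n + 1) ∣ G - 1) :
    coeff n (F * G) = coeff n F := by
  have e : F * G = F + F * (G - 1) := by ring
  rw [e, map_add, add_eq_left]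
  exact (PowerSeries.X_pow_dvd_iff.mp (hG.mul_left F)) n (Nat.lt_succ_self n)

/-- **Step 2, second half**: for every `M`, `coeff_n (Q_M³) ≤ coeff_n (Q_n³) =: B_n` (increasing in `M`,
stationary from `M = n`). [cite: HardyWright2008, §19.3] -/
theorem coeff_majorant_le (M n : ℕ) :
    coeff n ((∏ t ∈ range M, (1 + C 1 * (X : ℝ⟦X⟧) ^ (t + 1))) ^ 3) ≤
      coeff n ((∏ t ∈ range n, (1 + C 1 * (X : ℝ⟦X⟧) ^ (t + 1))) ^ 3) := by
  rcases le_total M n with hMn | hnM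
  · -- `Q_n³ = Q_M³ · (tail)³`, and the tail has non-negative coefficients and constant term 1
    rw [← Finset.prod_range_mul_prod_Ico _ hMn, mul_pow]
    exact coeff_le_coeff_mul (coeff_majorant_nonneg _ 3) (coeff_majorant_nonneg _ 3)
      (coeff_zero_majorant _ 3) n
  · -- `Q_M³ = Q_n³ · (tail ≡ 1 mod X^{n+1})³`
    rw [← Finset.prod_range_mul_prod_Ico _ hnM, mul_pow,
      coeff_mul_eq_of_X_pow_dvd (X_pow_dvd_majorant_sub_one n M 3)]

/-- For `M ≥ n` the `n`-th coefficient of `Q_M³` is `B_n`. [folklore] -/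
private theorem coeff_majorant_eq {M n : ℕ} (hnM : n ≤ M) :
    coeff n ((∏ t ∈ range M, (1 + C 1 * (X : ℝ⟦X⟧) ^ (t + 1))) ^ 3) =
      coeff n ((∏ t ∈ range n, (1 + C 1 * (X : ℝ⟦X⟧) ^ (t + 1))) ^ 3) := by
  rw [← Finset.prod_range_mul_prod_Ico _ hnM, mul_pow,
    coeff_mul_eq_of_X_pow_dvd (X_pow_dvd_majorant_sub_one n M 3)]

/-- **Step 2**: the uniform bound `|coeff_n (P_M³)| ≤ B_n` for all `M`.
[cite: HardyWright2008, §19.3] -/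
theorem norm_coeff_prod_one_sub_pow_three_le (M n : ℕ) :
    ‖coeff n ((∏ t ∈ range M, (1 - (X : 𝕜⟦X⟧) ^ (t + 1))) ^ 3)‖ ≤
      coeff n ((∏ t ∈ range n, (1 + C 1 * (X : ℝ⟦X⟧) ^ (t + 1))) ^ 3) :=
  (norm_coeff_prod_pow_three_le_coeff_majorant M n).trans (coeff_majorant_le M n)

/-- `(1 + r)(1 + r²)⋯(1 + r^N) ≤ e^{r/(1−r)}` for `0 ≤ r < 1`. [folklore] -/
private theorem prod_one_add_pow_le_exp {r : ℝ} (hr0 : 0 ≤ r) (hr1 : r < 1) (N : ℕ) :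
    ∏ t ∈ range N, (1 + r ^ (t + 1)) ≤ Real.exp (r / (1 - r)) := by
  have hsum : Summable fun i : ℕ ↦ r ^ (i + 1) := by
    simp_rw [pow_succ]
    exact (summable_geometric_of_lt_one hr0 hr1).mul_right r
  have htsum : ∑' i : ℕ, r ^ (i + 1) = r / (1 - r) := by
    simp_rw [pow_succ']
    rw [tsum_mul_left, tsum_geometric_of_lt_one hr0 hr1, div_eq_mul_inv]
  calc ∏ t ∈ range N, (1 + r ^ (t + 1)) ≤ ∏ t ∈ range N, Real.exp (r ^ (t + 1)) := by
        refine Finset.prod_le_prod (fun t _ ↦ by positivity) fun t _ ↦ ?_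
        rw [add_comm]; exact Real.add_one_le_exp _
    _ = Real.exp (∑ t ∈ range N, r ^ (t + 1)) := (Real.exp_sum _ _).symm
    _ ≤ Real.exp (r / (1 - r)) := by
        rw [← htsum]
        exact Real.exp_le_exp.mpr (Summable.sum_le_tsum _ (fun i _ ↦ by positivity) hsum)

/-- **Step 3**: `Σ_d B_d r^d < ∞` for `0 ≤ r < 1`, since `Σ_{d<N} B_d r^d ≤ Q_N(r)³ ≤ e^{3r/(1−r)}`.
[cite: HardyWright2008, §19.3] -/
theorem summable_coeff_majorant_mul_pow {r : ℝ} (hr0 : 0 ≤ r) (hr1 : r < 1) :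
    Summable fun d ↦ coeff d ((∏ t ∈ range d, (1 + C 1 * (X : ℝ⟦X⟧) ^ (t + 1))) ^ 3) * r ^ d := by
  refine summable_of_sum_range_le (c := Real.exp (r / (1 - r)) ^ 3)
    (fun d ↦ mul_nonneg (coeff_majorant_nonneg _ 3 d) (pow_nonneg hr0 d)) fun N ↦ ?_
  -- the partial sum up to `N` is a partial sum of the (finite) expansion of `Q_N(r)³`
  have hQ := hasSum_coeff_prod_one_add_C_mul_X_pow_pow_mul_pow (1 : ℝ) r N 3
  calc ∑ d ∈ range N, coeff d ((∏ t ∈ range d, (1 + C 1 * (X : ℝ⟦X⟧) ^ (t + 1))) ^ 3) * r ^ d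
      = ∑ d ∈ range N, coeff d ((∏ t ∈ range N, (1 + C 1 * (X : ℝ⟦X⟧) ^ (t + 1))) ^ 3) * r ^ d :=
        sum_congr rfl fun d hd ↦ by rw [coeff_majorant_eq (mem_range.mp hd).le]
    _ ≤ (∏ t ∈ range N, (1 + 1 * r ^ (t + 1))) ^ 3 :=
        sum_le_hasSum _ (fun d _ ↦ mul_nonneg (coeff_majorant_nonneg _ 3 d) (pow_nonneg hr0 d)) hQ
    _ ≤ Real.exp (r / (1 - r)) ^ 3 := by
        simp_rw [one_mul]
        exact pow_le_pow_left₀ (prod_nonneg fun t _ ↦ by positivity)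
          (prod_one_add_pow_le_exp hr0 hr1 N) 3

end Majorant

/-! ### §3. Theorem 357 at a point -/

section Analytic

variable {𝕜 : Type*} [NormedField 𝕜] [CompleteSpace 𝕜]

/-- The coefficients `c_d` of `(∏ (1 − Xⁿ))³` (the stationary value of `coeff_d (P_M³)`, `M ≥ d`),
written out from the tree's `coeff_prod_pow_three`; the series `Σ c_d x^d` converges absolutely for
`‖x‖ < 1`. [cite: HardyWright2008, §19.9 Thm 357] -/
theorem summable_coeff_mul_pow {x : 𝕜} (hx : ‖x‖ < 1) :
    Summable fun d ↦ coeff d ((∏ t ∈ range d, (1 - (X : 𝕜⟦X⟧) ^ (t + 1))) ^ 3) * x ^ d := by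
  refine .of_norm_bounded (summable_coeff_majorant_mul_pow (norm_nonneg x) hx) fun d ↦ ?_
  rw [norm_mul, norm_pow]
  exact mul_le_mul_of_nonneg_right (norm_coeff_prod_one_sub_pow_three_le d d)
    (pow_nonneg (norm_nonneg x) d)

/-- **Steps 1–4**: `Σ_d c_d x^d = (∏_{n≥1} (1 − xⁿ))³` for `‖x‖ < 1`, `c_d` the coefficients of the cube
of the product (as the stationary coefficients of `P_d³`). [cite: HardyWright2008, §19.9 Thm 357] -/
theorem hasSum_coeff_mul_pow {x : 𝕜} (hx : ‖x‖ < 1) :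
    HasSum (fun d ↦ coeff d ((∏ t ∈ range d, (1 - (X : 𝕜⟦X⟧) ^ (t + 1))) ^ 3) * x ^ d)
      ((∏' k, ((1 : 𝕜) - x ^ (k + 1))) ^ 3) := by
  -- Tannery: `Σ_d coeff_d(P_M³) x^d → Σ_d c_d x^d`
  have hlim : Tendsto (fun M ↦ ∑' d, coeff d ((∏ t ∈ range M, (1 - (X : 𝕜⟦X⟧) ^ (t + 1))) ^ 3) *
      x ^ d) atTop (𝓝 (∑' d, coeff d ((∏ t ∈ range d, (1 - (X : 𝕜⟦X⟧) ^ (t + 1))) ^ 3) * x ^ d)) := by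
    refine tendsto_tsum_of_dominated_convergence
      (summable_coeff_majorant_mul_pow (norm_nonneg x) hx) (fun d ↦ ?_)
      (Eventually.of_forall fun M d ↦ ?_)
    · refine tendsto_atTop_of_eventually_const (i₀ := d) fun M hM ↦ ?_
      rw [coeff_prod_pow_three 𝕜 d M hM, coeff_prod_pow_three 𝕜 d d le_rfl]
    · rw [norm_mul, norm_pow]
      exact mul_le_mul_of_nonneg_right (norm_coeff_prod_one_sub_pow_three_le M d)
        (pow_nonneg (norm_nonneg x) d)
  -- the left-hand sides are `P_M(x)³ → (∏ (1 − xⁿ))³`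
  have hP : Tendsto (fun M ↦ ∑' d, coeff d ((∏ t ∈ range M, (1 - (X : 𝕜⟦X⟧) ^ (t + 1))) ^ 3) *
      x ^ d) atTop (𝓝 ((∏' k, ((1 : 𝕜) - x ^ (k + 1))) ^ 3)) := by
    have h3 := ((multipliable_one_sub_pow_succ hx).hasProd.tendsto_prod_nat).pow 3
    refine h3.congr fun M ↦ ?_
    exact ((hasSum_coeff_prod_one_sub_pow_three_mul_pow x M).tsum_eq).symm
  rw [tendsto_nhds_unique hP hlim]
  exact (summable_coeff_mul_pow hx).hasSum

/-- **Hardy–Wright Theorem 357 (Jacobi) at a point**: for `‖x‖ < 1`,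
`Σ_{m≥0} (−1)ᵐ (2m+1) x^{½m(m+1)} = ((1 − x)(1 − x²)(1 − x³)…)³`.
[cite: HardyWright2008, §19.9 Thm 357] -/
theorem hasSum_jacobi {x : 𝕜} (hx : ‖x‖ < 1) :
    HasSum (fun m : ℕ ↦ (-1 : 𝕜) ^ m * (2 * m + 1) * x ^ (m * (m + 1) / 2))
      ((∏' k, ((1 : 𝕜) - x ^ (k + 1))) ^ 3) := by
  have h := hasSum_coeff_mul_pow hx
  -- the coefficient series is supported on the numbers `½m(m+1)`
  have hmono : StrictMono fun m : ℕ ↦ m * (m + 1) / 2 := by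
    refine strictMono_nat_of_lt_succ fun m ↦ ?_
    have e : (m + 1) * (m + 1 + 1) = m * (m + 1) + 2 * (m + 1) := by ring
    simp only [e, Nat.add_mul_div_left _ _ two_pos]
    omega
  have hinj : Function.Injective fun m : ℕ ↦ m * (m + 1) / 2 := hmono.injective
  rw [← hinj.hasSum_iff (fun d hd ↦ ?_)] at h
  · convert h using 1
    funext m
    simp only [Function.comp_apply]
    rw [coeff_prod_one_sub_X_pow_pow_three 𝕜 m _ le_rfl]
  · rw [coeff_prod_one_sub_X_pow_pow_three_eq_zero 𝕜 le_rfl hd, zero_mul]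

/-- **Theorem 357** as an equation, `‖x‖ < 1`:
`(∏_{n≥1} (1 − xⁿ))³ = Σ_{m≥0} (−1)ᵐ (2m+1) x^{½m(m+1)}`. [cite: HardyWright2008, §19.9 Thm 357] -/
theorem tprod_one_sub_pow_succ_pow_three_eq_tsum {x : 𝕜} (hx : ‖x‖ < 1) :
    (∏' k, ((1 : 𝕜) - x ^ (k + 1))) ^ 3 =
      ∑' m : ℕ, (-1 : 𝕜) ^ m * (2 * m + 1) * x ^ (m * (m + 1) / 2) :=
  (hasSum_jacobi hx).tsum_eq.symm

end Analytic

end Literature.Combinatorics.Enumerative.JacobiIdentityAnalytic
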